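import Summits.Ventures.GridStability.Models.DroopQVGainAffine

/-!
# GridStability/Models/DroopQVTauAffine — the droop+QV Jacobian is AFFINE in the inverse filter time constant `1/τ`: the ZERO-VIRTUAL-INERTIA ray of the parametric lane

Cell `gridfusion` (LADDER-GRIDFUSION, APEX LINE rung G3.b; seat gridfusion-model-8 (g4); generic half of the default-work item «G3.b-ss-DROOPQV-…-ZERO-INERTIA-RAY»,
sequel of `Models/DroopQVGainAffine.lean` p558197). In model N1 (`DroopMicrogrid`, [cite: KunduEtAl2019, eqs. (4a)–(4c)]) the low-pass filter time constant `τ`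
(`τ_P = τ_Q = τ` in [cite: KunduEtAl2019, §V]) is the VIRTUAL INERTIA of the equivalent swing model up to the gain (`M_i = τ/k_Pi`, `D_i = 1/k_Pi`,
`DroopMicrogrid.toClassicalSwing`); the low-inertia question «what happens as `τ → 0`» is a question about a RAY in `σ = 1/τ`:
* §1 `withTau τ` (the same microgrid with both filter constants set to `τ`): flows, set-points, rest points and sensitivity blocks unchanged; the angle rows of
  the Jacobian (`θ̇ = ω`) do not read `τ`, the frequency and voltage rows scale with `1/τ`: `jacMatrix (withTau τ) = jacBase + (1/τ) • jacTauSlope`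
  (`jacMatrix_withTau`), `jacTauSlope = [[0, 0, 0], [−diag(k_P)·Pθ, −1, −diag(k_P)·PV], [−diag(k_Q)·Qθ, 0, −(1 + diag(k_Q)·QV)]]`;
* §2 the deflation lane read for `withTau τ` (`eig_re_lt_neg_of_deflate_withTau`, `no_jordan_chain_at_zero_of_deflate_withTau`) and the ℚ-twins
  `DroopQVData.jacBaseQ`, `jacTauSlopeQ` with their bridges — instance files then certify a whole ray `σ ≥ σ₁` (every `0 < τ ≤ 1/σ₁`) with an affine
  Lyapunov family `S₀ + σ·S₁`, `S₁` supported on the ANGLE block (so `S₁·jacTauSlope = 0`), by `lyapCert_affine` + `posDef_affine_of_posSemidef_slope`.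
THREE COLUMNS. CERTIFIED (kernel): algebra about MODEL N1 (MV-6N); no numbers, no instance; no sentence of this file says a converter or a microgrid is stable.
-/

noncomputable section

open Real Matrix Finset
open scoped ComplexOrder

namespace Summit.Ventures.GridStability.Models

namespace DroopMicrogrid

variable {n : ℕ} (mg : DroopMicrogrid n)

/-- **The same droop microgrid with both low-pass filter time constants set to `τ`** (`τ_P = τ_Q = τ`; everything else unchanged). [cite: KunduEtAl2019, §V] -/
def withTau (τ : ℝ) : DroopMicrogrid n := { mg with τP := fun _ => τ, τQ := fun _ => τ }

variable (τ : ℝ)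

/-- Filter constants of `withTau τ`. [folklore] -/
@[simp] theorem withTau_τP (i : Fin n) : (mg.withTau τ).τP i = τ := rfl
/-- Filter constants of `withTau τ`. [folklore] -/
@[simp] theorem withTau_τQ (i : Fin n) : (mg.withTau τ).τQ i = τ := rfl
/-- Unchanged data of `withTau τ`. [folklore] -/
@[simp] theorem withTau_kP : (mg.withTau τ).kP = mg.kP := rfl
/-- Unchanged data of `withTau τ`. [folklore] -/
@[simp] theorem withTau_kQ : (mg.withTau τ).kQ = mg.kQ := rfl
/-- Unchanged data of `withTau τ`. [folklore] -/
@[simp] theorem withTau_Vset : (mg.withTau τ).Vset = mg.Vset := rfl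
/-- The flows do not read the filter constants. [folklore] -/
@[simp] theorem withTau_P : (mg.withTau τ).P = mg.P := rfl
/-- The flows do not read the filter constants. [folklore] -/
@[simp] theorem withTau_Q : (mg.withTau τ).Q = mg.Q := rfl
/-- The sensitivity blocks do not read the filter constants. [folklore] -/
@[simp] theorem withTau_Pθ : (mg.withTau τ).Pθ = mg.Pθ := rfl
/-- The sensitivity blocks do not read the filter constants. [folklore] -/
@[simp] theorem withTau_PV : (mg.withTau τ).PV = mg.PV := rfl
/-- The sensitivity blocks do not read the filter constants. [folklore] -/
@[simp] theorem withTau_Qθ : (mg.withTau τ).Qθ = mg.Qθ := rfl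
/-- The sensitivity blocks do not read the filter constants. [folklore] -/
@[simp] theorem withTau_QV : (mg.withTau τ).QV = mg.QV := rfl
/-- Frequency-row gains of `withTau τ`: `k_Pi/τ`. [folklore] -/
@[simp] theorem withTau_ΛP (i : Fin n) : (mg.withTau τ).ΛP i = mg.kP i / τ := rfl
/-- Voltage-row gains of `withTau τ`: `k_Qi/τ`. [folklore] -/
@[simp] theorem withTau_ΛQ (i : Fin n) : (mg.withTau τ).ΛQ i = mg.kQ i / τ := rfl

/-- **The steady states do not depend on the filter constants.** [cite: KunduEtAl2019, after (5b)] -/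
theorem withTau_isSteadyState_iff (θs : Fin n → ℝ) : (mg.withTau τ).IsSteadyState θs ↔ mg.IsSteadyState θs := Iff.rfl

/-- **The rest point does not move with `τ`.** [folklore] -/
theorem withTau_field_eq_zero {θs : Fin n → ℝ} (h : mg.IsSteadyState θs) : (mg.withTau τ).field (θs, 0, mg.Vset) = 0 :=
  (mg.withTau τ).field_eq_zero_of_isSteadyState ((mg.withTau_isSteadyState_iff τ θs).2 h)

/-- The `τ`-free part of the Jacobian: the angle rows `θ̇ = ω`. [folklore] -/
def jacBase (n : ℕ) : Matrix (Fin n ⊕ (Fin n ⊕ Fin n)) (Fin n ⊕ (Fin n ⊕ Fin n)) ℝ :=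
  Matrix.fromBlocks 0 (Matrix.fromCols 1 0) 0 0

/-- **The `1/τ`-slope of the Jacobian** at a state `(θ, V)`: the frequency and voltage rows at `τ = 1`,
`[[0, 0, 0], [−diag(k_P)·Pθ, −1, −diag(k_P)·PV], [−diag(k_Q)·Qθ, 0, −(1 + diag(k_Q)·QV)]]`. [folklore] -/
def jacTauSlope (θ V : Fin n → ℝ) : Matrix (Fin n ⊕ (Fin n ⊕ Fin n)) (Fin n ⊕ (Fin n ⊕ Fin n)) ℝ :=
  Matrix.fromBlocks 0 0
    (Matrix.fromRows (-(Matrix.diagonal mg.kP * mg.Pθ θ V)) (-(Matrix.diagonal mg.kQ * mg.Qθ θ V)))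
    (Matrix.fromBlocks (-1) (-(Matrix.diagonal mg.kP * mg.PV θ V)) 0 (-(1 + Matrix.diagonal mg.kQ * mg.QV θ V)))

/-- **The Jacobian is AFFINE in `σ = 1/τ`**: `jacMatrix (withTau τ) = jacBase + (1/τ) • jacTauSlope` (at every state, every `τ`; Lean's `x/0 = 0`
convention makes the identity unconditional). [folklore] -/
theorem jacMatrix_withTau (θ V : Fin n → ℝ) : (mg.withTau τ).jacMatrix θ V = jacBase n + (1 / τ) • mg.jacTauSlope θ V := by
  ext a b
  rcases a with i | i | i <;> rcases b with j | j | j <;>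
    simp [DroopMicrogrid.jacMatrix, jacBase, jacTauSlope, DroopMicrogrid.ΛP, DroopMicrogrid.ΛQ, Matrix.fromBlocks, Matrix.fromRows,
      Matrix.fromCols, Matrix.add_apply, Matrix.neg_apply, Matrix.one_apply, Matrix.diagonal_apply, Matrix.mul_apply] <;>
    (try split_ifs) <;> ring

/-- **The deflated Jacobian is affine in `1/τ` too.** [folklore] -/
theorem jacDefl_withTau (θ V : Fin n → ℝ) (ζ : Fin n ⊕ (Fin n ⊕ Fin n) → ℝ) :
    (mg.withTau τ).jacDefl θ V ζ = (jacBase n + Matrix.vecMulVec rot ζ) + (1 / τ) • mg.jacTauSlope θ V := by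
  rw [DroopMicrogrid.jacDefl, jacMatrix_withTau, add_right_comm]

/-! ## §2 The deflation lane for `withTau τ` -/

/-- **Deflation lane for the model with filter constant `τ`** (`eig_re_lt_neg_of_deflate`, p530169, read for `withTau τ`). CERTIFIED (matrix statement about
MODEL N1, MV-6N); no instance. [folklore] -/
theorem eig_re_lt_neg_of_deflate_withTau (θ V : Fin n → ℝ) (ζ : Fin n ⊕ (Fin n ⊕ Fin n) → ℝ) {r₀ : ℝ} (hr₀ : 0 < r₀)
    (hγ : ∑ k, ζ k * rot k < -r₀) {S : Matrix (Fin n ⊕ (Fin n ⊕ Fin n)) (Fin n ⊕ (Fin n ⊕ Fin n)) ℝ} (hS : S.PosDef)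
    (hH : (S * (-(mg.withTau τ).jacDefl θ V ζ) + (S * (-(mg.withTau τ).jacDefl θ V ζ))ᵀ - (2 * r₀) • S).PosDef)
    {z : ℂ} {v : Fin n ⊕ (Fin n ⊕ Fin n) → ℂ} (hv : v ≠ 0)
    (hJv : ((mg.withTau τ).jacMatrix θ V).map ((↑) : ℝ → ℂ) *ᵥ v = z • v) :
    (z = 0 ∧ ∃ a : ℂ, v = fun k => a * (rot k : ℂ)) ∨ z.re < -r₀ :=
  (mg.withTau τ).eig_re_lt_neg_of_deflate θ V ζ hr₀ hγ hS hH hv hJv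

/-- **No Jordan chain at the rotation zero, `τ`-parametric version.** [folklore] -/
theorem no_jordan_chain_at_zero_of_deflate_withTau (θ V : Fin n → ℝ) (ζ : Fin n ⊕ (Fin n ⊕ Fin n) → ℝ) {r₀ : ℝ} (hr₀ : 0 < r₀)
    (hγ : ∑ k, ζ k * rot k < -r₀) {S : Matrix (Fin n ⊕ (Fin n ⊕ Fin n)) (Fin n ⊕ (Fin n ⊕ Fin n)) ℝ} (hS : S.PosDef)
    (hH : (S * (-(mg.withTau τ).jacDefl θ V ζ) + (S * (-(mg.withTau τ).jacDefl θ V ζ))ᵀ - (2 * r₀) • S).PosDef)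
    {w : Fin n ⊕ (Fin n ⊕ Fin n) → ℂ}
    (hw : ((mg.withTau τ).jacMatrix θ V).map ((↑) : ℝ → ℂ) *ᵥ w = fun k => ((rot k : ℝ) : ℂ)) : False :=
  (mg.withTau τ).no_jordan_chain_at_zero_of_deflate θ V ζ hr₀ hγ hS hH hw

end DroopMicrogrid

/-! ## §3 The ℚ-twins of the two parts at the operating point of a `DroopQVData` instance -/

namespace DroopQVData

variable {n : ℕ} (d : DroopQVData n)

/-- ℚ-twin of `jacBase`. [folklore] -/
def jacBaseQ (n : ℕ) : Matrix (Fin (n + 1) ⊕ (Fin (n + 1) ⊕ Fin (n + 1))) (Fin (n + 1) ⊕ (Fin (n + 1) ⊕ Fin (n + 1))) ℚ :=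
  Matrix.fromBlocks 0 (Matrix.fromCols 1 0) 0 0

/-- ℚ-twin of `jacTauSlope (θ*, V*)`. [folklore] -/
def jacTauSlopeQ : Matrix (Fin (n + 1) ⊕ (Fin (n + 1) ⊕ Fin (n + 1))) (Fin (n + 1) ⊕ (Fin (n + 1) ⊕ Fin (n + 1))) ℚ :=
  Matrix.fromBlocks 0 0
    (Matrix.fromRows (-(Matrix.diagonal d.kP * d.PθQ)) (-(Matrix.diagonal d.kQ * d.QθQ)))
    (Matrix.fromBlocks (-1) (-(Matrix.diagonal d.kP * d.PVQ)) 0 (-(1 + Matrix.diagonal d.kQ * d.QVQ)))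

/-- **Bridge for the base**: `jacBase` IS `jacBaseQ` cast. [folklore] -/
theorem jacBase_eq (n : ℕ) : DroopMicrogrid.jacBase (n + 1) = (jacBaseQ n).map ((↑) : ℚ → ℝ) := by
  rw [DroopMicrogrid.jacBase, jacBaseQ]
  ext (i | i | i) (j | j | j) <;> simp [Matrix.fromBlocks, Matrix.fromCols, Matrix.one_apply, apply_ite ((↑) : ℚ → ℝ)]

/-- **Bridge for the slope**: `jacTauSlope (θ*, V*)` of the instance model IS `jacTauSlopeQ` cast. [folklore] -/
theorem jacTauSlope_eq (hcirc : ∀ i, d.s i ^ 2 + d.c i ^ 2 = 1) :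
    d.toMicrogrid.jacTauSlope d.angleOf d.Vstar = d.jacTauSlopeQ.map ((↑) : ℚ → ℝ) := by
  have hg := fun i => d.toMicrogrid_gains i
  rw [DroopMicrogrid.jacTauSlope, d.Pθ_eq hcirc, d.PV_eq hcirc, d.Qθ_eq hcirc, d.QV_eq hcirc, jacTauSlopeQ]
  ext (i | i | i) (j | j | j) <;>
    simp [Matrix.fromBlocks, Matrix.fromRows, Matrix.mul_apply, Matrix.diagonal_apply, Matrix.one_apply, apply_ite ((↑) : ℚ → ℝ),
      (hg i).2.2.1, (hg i).2.2.2.1]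

end DroopQVData

end Summit.Ventures.GridStability.Models

end
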